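/-
Copyright: statement-level skeleton of a published paper (lit-balaban cell, Phase-2 proof seat p25, gen 18). No proof
claims beyond what the kernel checks below.
-/
import Literature.MathematicalPhysics.QuantumFieldTheory.BalabanImbrieJaffe1984to88.BIJ88WalkRemainderFieldLaw312
import Literature.MathematicalPhysics.QuantumFieldTheory.BalabanImbrieJaffe1984to88.BIJ88WalkTermNorm312

/-!
# `BalabanImbrieJaffe1984to88.BIJ88WalkRemainderBound312` — T. Bałaban, J. Imbrie, A. Jaffe, *Effective action and
cluster properties of the abelian Higgs model*, Commun. Math. Phys. **114** (1988) 257–315 [BalabanImbrieJaffe1988],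
§5.14 p. 312 [PDF 56], verbatim: *"Summing all terms in X_r gives an observable F_{k,rem}(X_r)"*, *"The main source of
concern in estimating G_k(X_r) is that we only have bounds |F_{k,loc}(X_{σ₁})| ≤ c(L^kε)^{−m(c)}e^{−m′(c)} … By
performing sufficiently many integrations by parts, we have arranged for enough small factors to beat these large
factors in the remainder terms"* — **THE REMAINDER PART ON THE LAW IS AT MOST LARGE FACTORS TIMES `c(F)`, UNIFORMLY IN
THE VOLUME** (p25 gen 18): with the covariance split on the §5.13 model of record, if every remainder term's
normalized expectation is bounded by `K_χ·Π_{z∈dirs}‖z‖·Λ` (the cutoff derivatives and the moments of the legs on the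
law — large factors), then `|remv(O)/Z| ≤ K_χ·Λ·W^{Φ₀(O)}·Π_{j∈O} B_ℓ^{|obs j|}` (`abs_remv_div_le`) by the
volume-uniform term norm `BIJ88WalkTermNorm312.expand_l1_free_le` (the small factors `θ^{#free}` thrown away here;
keeping them per remainder component is the next generation's `G_k(X_r)`).

statement-level skeleton of published theorems with citation tags; proofs where landed; nothing here is a claim
about the Yang–Mills mass gap

PDF held: `paper:balaban1988-cmp114-bij-abelian-higgs-effective-action` (journal page = PDF page + 256); p. 312 =
PDF 56 (`p0056.txt` L1–25 re-read this session, 2026-08-22).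

CITATION HEADER (lean-in-tree rule).  lit-balaban cell (HOME `run/shared/lean/pub/lit-balaban/`), Phase 2, seat p25
gen 18; row **C2.Claim@312** of `HOME/lit-balaban-r16/ROWS-C2-part2.md` (owner r16, referee ref-5; head
`BIJ88Sect5StatementsPart4.Ineq312` untouched — MEMBER of the row).  USED BY NAME, nothing restated:
`BIJ88WalkRemainderFieldLaw312.remv_div_eq_sum_fieldLaw`, `BIJ88WalkTermNorm312.expand_l1_free_le`,
`BIJ88WalkResummation312.remv`, `BIJ88WalkExpansion311.expand` (this seat and generation),
`BIJ88Resummation312.sum_map_ite` (p25 gen 17), the §5.13 model `prec`/`src`/`fieldLaw` (p36, r-seats).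

## What is proved (0 `sorry`, standard axioms, no new `Prop` facts; theorems only)

* **`abs_remv_div_le`**.
HONEST SCOPE: (a) the expectation bound `K_χ·Π‖dirs‖·Λ` is a HYPOTHESIS (Λ uniform over the terms of `expand 0 O`,
e.g. a moment bound of the total pending legs `≤ Φ₀(O)` — not derived here); (b) NO small factor is kept (the
`θ^{#free}` of `expand_l1_free_le` is discarded by `θ ≤ 1`; the χ′ shell factor of `abs_remTerm_le_shell` is not
inserted); (c) locality/convergence hypotheses abstract, constant `W^{Φ₀(O)}`; (d) contraction-graph components;
(e) no `Ineq312` binder.  NOT summit progress; NOT continuum; NOT Clay.  Imports `BIJ88WalkRemainderFieldLaw312`,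
`BIJ88WalkTermNorm312`; modifies nothing.
-/

noncomputable section

namespace Literature.MathematicalPhysics.QuantumFieldTheory.BalabanImbrieJaffe1984to88.BIJ88WalkRemainderBound312

open Classical MeasureTheory Matrix Finset
open scoped BigOperators
open Literature.MathematicalPhysics.QuantumFieldTheory.Balaban1983to89
open B2Eq228Conditioning (weight source)
open BIJ88PolymerRep5134 (corner)
open BIJ88PolymerRep5134Gauss (prec src)
open BIJ88SlotMomentsGauss308 (fieldLaw)
open BIJ88VertexIbp311 (vexp)
open BIJ88WickDerivatives305 (dlist)
open BIJ88VertexComponents311 (maxArity)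
open BIJ88Resummation312 (sum_map_ite)
open BIJ88WalkRun311 BIJ88WalkGeometry311 BIJ88WalkExpansion311 BIJ88WalkResummation312 BIJ88WalkRemainderFieldLaw312
  BIJ88WalkTermNorm312

variable {ι : Type} [Fintype ι] {κ : Type} [LinearOrder κ] {P : Type} [Fintype P] {β : Type} [DecidableEq β]
variable {α I : Type} [Fintype α] [DecidableEq α] [Fintype I] [DecidableEq I]
  {blk : α → I} {Δ : Matrix α α ℝ} {ℱ : α → ℝ} {W : Finset I}

/-- **THE REMAINDER PART ON THE LAW IS AT MOST LARGE FACTORS TIMES `c(F)`**: on the §5.13 model of record with the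
covariance split `Σ_p Cov p = (prec)⁻¹`, under the bracket/coupling/locality hypotheses of
`BIJ88WalkTermNorm312.expand_l1_free_le` (with the source `src` as `f`) and an expectation bound
`|𝔼_W[Π_{legs}Φ·(Π_{dirs t}∂)χ·e^{−V}]| ≤ K_χ·Π_{z∈dirs t}‖z‖·Λ` for the remainder terms of `expand 0 O`:
`|remv(O)/Z| ≤ K_χ·Λ·(W^{Φ₀(O)}·Π_{j∈O} B_ℓ^{|obs j|})`. [cite: BalabanImbrieJaffe1988, §5.14 p.312] -/
theorem abs_remv_div_le (hPD : (prec blk Δ W (corner ℝ W)).PosDef)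
    {Cov : P → Matrix {x : α // blk x ∈ W} {x : α // blk x ∈ W} ℝ} {trig : P → Bool} {c : ι → ℝ}
    {legs : ι → List ({x : α // blk x ∈ W} → ℝ)} {obs : κ → List ({x : α // blk x ∈ W} → ℝ)} {M : ℕ}
    {χ : ({x : α // blk x ∈ W} → ℝ) → ℝ} {oc : κ → Finset β} {vc : ι → Finset β} {reg : P → Finset β}
    {Dir : Set ({x : α // blk x ∈ W} → ℝ)} {B' ρ : P → ℝ} {cV : ι → ℝ} {Bl θ ρ₀ Wc Kχ Λ : ℝ} {N₀ : ℕ}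
    (hθ0 : 0 < θ) (hθ1 : θ ≤ 1) (hBl : 1 ≤ Bl) (hB0 : ∀ p, 0 ≤ B' p) (hρ : ∀ p, 0 ≤ ρ p) (hcV0 : ∀ m, 0 ≤ cV m)
    (hB : ∀ p, ∀ u ∈ Dir, ∀ w ∈ Dir, |(Cov p *ᵥ u) ⬝ᵥ w| ≤ B' p * ρ p)
    (hBf : ∀ p, ∀ u ∈ Dir, |(Cov p *ᵥ u) ⬝ᵥ src blk ℱ W| ≤ B' p * ρ p)
    (hBz : ∀ p, ∀ u ∈ Dir, ‖Cov p *ᵥ u‖ ≤ B' p * ρ p)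
    (hcV : ∀ m, |c m| ≤ cV m) (hobs : ∀ j, ∀ w ∈ obs j, w ∈ Dir) (hlegs : ∀ m, ∀ w ∈ legs m, w ∈ Dir)
    (hloc : ∀ p, trig p = false → B' p ≤ Bl ∧ reg p = ∅) (hwalk : ∀ p, trig p = true → B' p ≤ θ ^ (reg p).card)
    (hvert : ∀ m, cV m * Bl ^ (legs m).length ≤ θ ^ (vc m).card) (hρ₀0 : 0 ≤ ρ₀)
    (hρ₀ : ∀ u ∈ Dir, (∑ p ∈ univ.filter (fun p => Cov p *ᵥ u ≠ 0), ρ p) ≤ ρ₀)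
    (hN : ∀ p, ∀ u ∈ Dir,
      (∑ m, ((range (legs m).length).filter fun j => (Cov p *ᵥ u) ⬝ᵥ (legs m).getD j 0 ≠ 0).card) ≤ N₀)
    (O : Finset κ) (hW1 : 1 ≤ Wc)
    (hW : ρ₀ * ((∑ j ∈ O, ((obs j).length + 1 + M * maxArity legs) + N₀ : ℕ) : ℝ) ≤ Wc)
    (hKχ : 0 ≤ Kχ) (hΛ : 0 ≤ Λ)
    (hE : ∀ t ∈ expand Cov trig (src blk ℱ W) c legs obs M 0 O, t.consts = 0 →
      |∫ φ, ((t.groups.map fun h => (h.pend : Multiset _)).sum.map fun w => φ ⬝ᵥ w).prod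
          * (dlist t.dirs χ φ * vexp c legs φ) ∂(fieldLaw blk Δ ℱ W)|
        ≤ Kχ * (t.dirs.map fun z => ‖z‖).prod * Λ) :
    |remv (prec blk Δ W (corner ℝ W)) Cov trig (src blk ℱ W) c legs obs M χ [] 0 O
        / ∫ φ, weight (prec blk Δ W (corner ℝ W)) φ * source (src blk ℱ W) φ|
      ≤ Kχ * Λ * (Wc ^ (∑ j ∈ O, ((obs j).length + 1 + M * maxArity legs)) * ∏ j ∈ O, Bl ^ (obs j).length) := by
  have hfree := expand_l1_free_le (oc := oc) (vc := vc) (reg := reg) hθ0 hθ1 hBl hB0 hρ hcV0 hB hBf hBz hcV hobs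
    hlegs hloc hwalk hvert hρ₀0 hρ₀ hN O hW1 hW
  rw [remv_div_eq_sum_fieldLaw hPD, ← sum_map_ite]
  refine Multiset.abs_sum_le_sum_abs.trans ?_
  rw [Multiset.map_map]
  -- pointwise: a remainder term is at most `K_χ·Λ` times its size in units of `θ^{#free}`
  have hpt : ∀ t ∈ expand Cov trig (src blk ℱ W) c legs obs M 0 O,
      ((fun x : ℝ => |x|) ∘ fun t : WTerm {x : α // blk x ∈ W} κ ι P => if t.consts = 0 then
          t.coef * ∫ φ, ((t.groups.map fun h => (h.pend : Multiset _)).sum.map fun w => φ ⬝ᵥ w).prod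
            * (dlist t.dirs χ φ * vexp c legs φ) ∂(fieldLaw blk Δ ℱ W) else 0) t
        ≤ Kχ * Λ * (|t.coef| * (t.dirs.map fun z => ‖z‖).prod
            * (θ ^ ((t.consts + t.groups).map fun X => (cubes oc vc reg X \ X.lab.biUnion oc).card).sum)⁻¹) := by
    intro t ht
    have hsz : 0 ≤ |t.coef| * (t.dirs.map fun z => ‖z‖).prod :=
      mul_nonneg (abs_nonneg _) (List.prod_nonneg fun x hx => by
        obtain ⟨z, -, rfl⟩ := List.mem_map.1 hx; exact norm_nonneg z)
    have hinv : 1 ≤ (θ ^ ((t.consts + t.groups).map fun X => (cubes oc vc reg X \ X.lab.biUnion oc).card).sum)⁻¹ :=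
      one_le_inv_iff₀.2 ⟨pow_pos hθ0 _, pow_le_one₀ hθ0.le hθ1⟩
    have hR : 0 ≤ Kχ * Λ * (|t.coef| * (t.dirs.map fun z => ‖z‖).prod
        * (θ ^ ((t.consts + t.groups).map fun X => (cubes oc vc reg X \ X.lab.biUnion oc).card).sum)⁻¹) :=
      mul_nonneg (mul_nonneg hKχ hΛ) (mul_nonneg hsz (zero_le_one.trans hinv))
    simp only [Function.comp_apply]
    split_ifs with hc
    · rw [abs_mul]
      calc |t.coef| * |∫ φ, ((t.groups.map fun h => (h.pend : Multiset _)).sum.map fun w => φ ⬝ᵥ w).prod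
              * (dlist t.dirs χ φ * vexp c legs φ) ∂(fieldLaw blk Δ ℱ W)|
          ≤ |t.coef| * (Kχ * (t.dirs.map fun z => ‖z‖).prod * Λ) :=
            mul_le_mul_of_nonneg_left (hE t ht hc) (abs_nonneg _)
        _ = Kχ * Λ * (|t.coef| * (t.dirs.map fun z => ‖z‖).prod) := by ring
        _ ≤ _ := mul_le_mul_of_nonneg_left (le_mul_of_one_le_right hsz hinv) (mul_nonneg hKχ hΛ)
    · rw [abs_zero]
      exact hR
  calc _ ≤ ((expand Cov trig (src blk ℱ W) c legs obs M 0 O).map fun t => Kχ * Λ * (|t.coef|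
          * (t.dirs.map fun z => ‖z‖).prod
          * (θ ^ ((t.consts + t.groups).map fun X => (cubes oc vc reg X \ X.lab.biUnion oc).card).sum)⁻¹)).sum :=
        Multiset.sum_map_le_sum_map _ _ hpt
    _ = Kχ * Λ * ((expand Cov trig (src blk ℱ W) c legs obs M 0 O).map fun t => |t.coef|
          * (t.dirs.map fun z => ‖z‖).prod
          * (θ ^ ((t.consts + t.groups).map fun X => (cubes oc vc reg X \ X.lab.biUnion oc).card).sum)⁻¹).sum := by
        rw [Multiset.sum_map_mul_left]
    _ ≤ _ := mul_le_mul_of_nonneg_left hfree (mul_nonneg hKχ hΛ)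

end Literature.MathematicalPhysics.QuantumFieldTheory.BalabanImbrieJaffe1984to88.BIJ88WalkRemainderBound312

end
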